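/-
Copyright: the b2b-balaban T⁴-continuum CRUX team, row NE7b OWNER lineage `t4-ne7b-p1` (gen 124). Project licence.
-/
import Summits.QuantumFields.BalabanUV.T4Continuum.Spine.NE7b.SupZdCoarseInverseIdentities
import Summits.QuantumFields.BalabanUV.T4Continuum.Spine.NE7b.SupZdPropagatorOperator

/-!
# THE INFINITE-VOLUME NEXT-SCALE HESSIAN IS A BOUNDEDLY INVERTIBLE OPERATOR ON `ℓ^∞(ℤ^d)`: the coarse operator `T_∞ = Q′H_∞⁻¹Q′*`
# (rows `Σ′_{b′}T_∞(b,b′)g(b′)`) and the kernel `M` of (194)∕(195) (rows `Σ′_{b′}M(b,b′)g(b′)`) are bounded operators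
# `Top, Mop ∈ L(ℓ^∞(ℤ^d))` with `‖Top‖, ‖Mop‖ ≤ C(d, a, λ, Λ)` and `Top∘Mop = Mop∘Top = 1` — every `V : ℤ^d → [−λ, Λ]`, `d ≥ 3`, every mesh;
# `(n+1)^d·Mop` is the infinite-volume next-scale Hessian as an OPERATOR in the sup road's currency ((48)∕(188)) (row NE7b, node U5c;
# (186)∕(189)∕(194)∕(195) BY NAME; [folklore])

Cell `pub-balaban`, sub-cell `t4`, spine estimate NE7b (`T4WeightBudget.RelWeightBound`; the cell's OWN estimate — NOT PRINTED in
[Bałaban 1983–89], NOT PROVED).  Crux-route work under `Spine/NE7b/` by the row OWNER (`t4-ne7b-p1` gen 124, file (203)) under FREEZE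
(0)'s crux-prover clause; NOTHING of Bałaban's is named as a Lean object, valued or asserted; no `T4Continuum/Support` leaf typed; no `def`,
no notation (the operators are `∃` of Mathlib's `→L[ℝ]` on `lp (fun _ : X d => ℝ) ∞` with their actions DISPLAYED); zero `sorry`.
Imports (BY NAME): the OWNER's (195) `…SupZdCoarseInverseIdentities` (`zd_coarse_mul_inverse`, `zd_coarse_inverse_mul`; through it (194)
`zd_coarse_section_inverse`, (189) `summable_kernel_row`, `tsum_kernel_row_le`, `summable_exp_l1`, `tsum_exp_l1_le`, (186)
`zd_coarse_entry_decay`), (188) `…SupZdPropagatorOperator` (the `lp∞` currency; (48) `abs_apply_le_norm`), Mathlib's `memℓp_infty`,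
`lp.norm_le_of_forall_le`, `LinearMap.mkContinuous`, `summable_prod_of_nonneg`, `Summable.tsum_comm`.

WHY (located).  (188) packaged `H_V⁻¹` as an element of `L(ℓ^∞(ℤ^d))`; the road's next-scale Hessian lives in the same currency.  With
(194)∕(195) the kernel `M` is in hand with decay, symmetry and the row identities `T_∞M = MT_∞ = 1`; exponentially decaying kernels act
boundedly on `ℓ^∞` by (189)'s row bounds (§1 `kernel_clm`), and the composition of two such operators is the operator of the composed
kernel — one Fubini on `ℤ^d × ℤ^d` under the domination `CC′‖g‖e^{−δ|b−b′|₁}e^{−δ′|b′−b″|₁}` (§1 `kernel_comp_apply`) — so the row identities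
become `Top∘Mop = Mop∘Top = 1`.

WHAT IS PROVED ([folklore]; `X d = ℤ^d`, `ℓ^∞ = lp (fun _ : X d => ℝ) ∞`): §1 **`kernel_clm`** (`|K(b,b′)| ≤ Ce^{−δ|b−b′|₁}` ⟹ `∃ Kop ∈ L(ℓ^∞)`,
`(Kop g)(b) = Σ′_{b′}K(b,b′)g(b′)`, `‖Kop‖ ≤ CK_δ`), **`kernel_comp_apply`** (two decaying kernels and a bounded `g`:
`Σ′_{b′}K(b,b′)Σ′_{b″}L(b′,b″)g(b″) = Σ′_{b″}(Σ′_{b′}K(b,b′)L(b′,b″))g(b″)`); §2 **`zd_coarse_inverse_clm`** (THE END: `∃ C > 0`: for ALL `n, V, Ψ`, ANY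
cube limit `M`: `∃ Top Mop ∈ L(ℓ^∞)` with the displayed rows, `‖Top‖, ‖Mop‖ ≤ C`, `Top(Mop g) = g = Mop(Top g)`); §3 toy.

HONEST (what this is NOT).  `ℓ^∞` packaging only (the `ℓ²` operator with `‖Mop‖ ≤ γ⁻¹` from (186)'s floor is not typed here); the LINEAR
column only; `d ≥ 3` only; scalar skeleton ((A3), NC-NE7b-α UNRULED); nothing of the covariant propagators of [B4]–[B6]; nothing of Bałaban's
asserted.  BY-NAME EFFECT ON THE WALL: NONE.  NE7b NOT PRINTED ∕ NOT PROVED; spine PROVED 0∕9; rung (B)+1 — the programme's measures remain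
FINITE-torus statements; NOT the mass gap, NOT Clay.  HONEST DEPENDENCY: continuum YM on T⁴ ⇐ BetaPertH ∧ nine spine estimates (0∕9
proved); BetaPertH ⇐ (D1) ∧ (D4) ∧ CAP+tail; G-an2-4 gates asym, D1 and NE2∕3∕4.
-/

set_option autoImplicit false

noncomputable section

namespace Summit.QuantumFields.BalabanUV.T4Continuum.NE7b.SupZdCoarseInverseOperator

open Real Filter Topology
open scoped ENNReal
open Literature.MathematicalPhysics.QuantumFieldTheory.Balaban1983to89
open B6QGQLower276 (X e blk B side chart mem_B sum_B sum_B_const card_cube blk_chart)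
open SupZdExponentialSums (summable_exp_l1 tsum_exp_l1_le summable_kernel_row tsum_kernel_row_le)
open SupZdCoarseOperator (zd_coarse_entry_decay)
open SupZdCoarseInverse (zd_coarse_section_inverse)
open SupZdCoarseInverseIdentities (zd_coarse_mul_inverse zd_coarse_inverse_mul)
open OneShotChartSupOperator (abs_apply_le_norm)

variable {d : ℕ}

/-! ## §1. An exponentially decaying kernel on `ℤ^d` is a bounded operator on `ℓ^∞(ℤ^d)` -/

/-- **DECAYING KERNELS ACT ON `ℓ^∞(ℤ^d)`**: `|K(b,b′)| ≤ C·e^{−δ|b − b′|₁}` ⟹ `∃ Kop : ℓ^∞ →L[ℝ] ℓ^∞` with `(Kop g)(b) = Σ′_{b′}K(b,b′)g(b′)` and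
`‖Kop‖ ≤ C·K_δ` — (189)'s row bounds, linearity by `tsum_add`∕`tsum_mul_left`, `mkContinuous`. [folklore] -/
theorem kernel_clm {C δ : ℝ} (hC : 0 ≤ C) (hδ : 0 < δ) (K : X d → X d → ℝ)
    (hK : ∀ b b', |K b b'| ≤ C * exp (-(δ * ∑ i, (((b i - b' i).natAbs : ℕ) : ℝ)))) :
    ∃ Kop : lp (fun _ : X d => ℝ) ∞ →L[ℝ] lp (fun _ : X d => ℝ) ∞,
      ‖Kop‖ ≤ C * (2 * (1 - exp (-δ))⁻¹) ^ d ∧ ∀ (g : lp (fun _ : X d => ℝ) ∞) (b : X d), Kop g b = ∑' b' : X d, K b b' * g b' := by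
  classical
  have hKδ : 0 ≤ (2 * (1 - exp (-δ))⁻¹) ^ d :=
    pow_nonneg (mul_nonneg zero_le_two (inv_nonneg.2 (sub_nonneg.2 (exp_le_one_iff.2 (by linarith))))) d
  have hs : ∀ (g : lp (fun _ : X d => ℝ) ∞) (b : X d), Summable fun b' : X d => K b b' * g b' :=
    fun g b => summable_kernel_row hδ K hK (fun b' => g b') (fun b' => abs_apply_le_norm g b') b
  have hbd : ∀ (g : lp (fun _ : X d => ℝ) ∞) (b : X d), |∑' b' : X d, K b b' * g b'| ≤ C * (2 * (1 - exp (-δ))⁻¹) ^ d * ‖g‖ :=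
    fun g b => tsum_kernel_row_le hδ K hK (fun b' => g b') (fun b' => abs_apply_le_norm g b') b
  have hmem : ∀ g : lp (fun _ : X d => ℝ) ∞, Memℓp (fun b : X d => ∑' b' : X d, K b b' * g b') ∞ := fun g =>
    memℓp_infty ⟨C * (2 * (1 - exp (-δ))⁻¹) ^ d * ‖g‖, by
      rintro _ ⟨b, rfl⟩
      show ‖∑' b' : X d, K b b' * g b'‖ ≤ _
      rw [Real.norm_eq_abs]; exact hbd g b⟩
  let K₀ : lp (fun _ : X d => ℝ) ∞ → lp (fun _ : X d => ℝ) ∞ := fun g => ⟨fun b => ∑' b' : X d, K b b' * g b', hmem g⟩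
  have hK₀ : ∀ (g : lp (fun _ : X d => ℝ) ∞) (b : X d), K₀ g b = ∑' b' : X d, K b b' * g b' := fun _ _ => rfl
  let Kl : lp (fun _ : X d => ℝ) ∞ →ₗ[ℝ] lp (fun _ : X d => ℝ) ∞ :=
    { toFun := K₀
      map_add' := fun f g => lp.ext (funext fun b => by
        rw [lp.coeFn_add, Pi.add_apply, hK₀, hK₀, hK₀, ← Summable.tsum_add (hs f b) (hs g b)]
        exact tsum_congr fun b' => by rw [lp.coeFn_add, Pi.add_apply, mul_add])
      map_smul' := fun c f => lp.ext (funext fun b => by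
        rw [lp.coeFn_smul, Pi.smul_apply, RingHom.id_apply, hK₀, hK₀, smul_eq_mul, ← tsum_mul_left]
        exact tsum_congr fun b' => by rw [lp.coeFn_smul, Pi.smul_apply, smul_eq_mul]; ring) }
  have hb : ∀ g, ‖Kl g‖ ≤ C * (2 * (1 - exp (-δ))⁻¹) ^ d * ‖g‖ := fun g =>
    lp.norm_le_of_forall_le (by positivity) fun b => by rw [Real.norm_eq_abs]; exact hbd g b
  exact ⟨Kl.mkContinuous _ hb, Kl.mkContinuous_norm_le (by positivity) hb, fun g b => rfl⟩

/-- **COMPOSITION OF DECAYING KERNELS ON `ℓ^∞`**: for `|K(b,b′)| ≤ C e^{−δ|b−b′|₁}`, `|L(b′,b″)| ≤ C′e^{−δ′|b′−b″|₁}` and bounded `g`,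
`Σ′_{b′}K(b,b′)(Σ′_{b″}L(b′,b″)g(b″)) = Σ′_{b″}(Σ′_{b′}K(b,b′)L(b′,b″))g(b″)` — Fubini on `ℤ^d × ℤ^d` (domination
`CC′‖g‖e^{−δ|b−b′|₁}e^{−δ′|b′−b″|₁}`, summable fibrewise then in `b′`). [folklore] -/
theorem kernel_comp_apply {C δ C' δ' Mg : ℝ} (hδ : 0 < δ) (hδ' : 0 < δ') (K L : X d → X d → ℝ)
    (hK : ∀ b b', |K b b'| ≤ C * exp (-(δ * ∑ i, (((b i - b' i).natAbs : ℕ) : ℝ))))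
    (hL : ∀ b' b'', |L b' b''| ≤ C' * exp (-(δ' * ∑ i, (((b' i - b'' i).natAbs : ℕ) : ℝ)))) (g : X d → ℝ) (hg : ∀ b'', |g b''| ≤ Mg)
    (b : X d) :
    ∑' b' : X d, K b b' * ∑' b'' : X d, L b' b'' * g b'' = ∑' b'' : X d, (∑' b' : X d, K b b' * L b' b'') * g b'' := by
  classical
  have hC : 0 ≤ C := by
    have h := (abs_nonneg _).trans (hK b b); exact le_of_mul_le_mul_right (by rw [zero_mul]; exact h) (exp_pos _)
  have hC' : 0 ≤ C' := by
    have h := (abs_nonneg _).trans (hL b b); exact le_of_mul_le_mul_right (by rw [zero_mul]; exact h) (exp_pos _)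
  have hMg : 0 ≤ Mg := (abs_nonneg _).trans (hg b)
  set F : X d → X d → ℝ := fun b' b'' => K b b' * L b' b'' * g b'' with hF
  set G : X d × X d → ℝ := fun p => C * exp (-(δ * ∑ i, (((b i - p.1 i).natAbs : ℕ) : ℝ)))
    * (C' * exp (-(δ' * ∑ i, (((p.1 i - p.2 i).natAbs : ℕ) : ℝ)))) * Mg with hG
  have hG0 : 0 ≤ G := fun p => by simp only [hG]; positivity
  have hGsum : Summable G := by
    refine (summable_prod_of_nonneg hG0).2 ⟨fun b' => ?_, ?_⟩
    · simp only [hG]; exact (((summable_exp_l1 hδ' b').mul_left C').mul_left _).mul_right Mg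
    · simp only [hG]
      have hrow : ∀ b' : X d, ∑' b'' : X d, C * exp (-(δ * ∑ i, (((b i - b' i).natAbs : ℕ) : ℝ)))
          * (C' * exp (-(δ' * ∑ i, (((b' i - b'' i).natAbs : ℕ) : ℝ)))) * Mg
          = C * C' * Mg * exp (-(δ * ∑ i, (((b i - b' i).natAbs : ℕ) : ℝ)))
            * ∑' b'' : X d, exp (-(δ' * ∑ i, (((b' i - b'' i).natAbs : ℕ) : ℝ))) := by
        intro b'; rw [← tsum_mul_left]; exact tsum_congr fun b'' => by ring
      simp only [hrow]
      refine Summable.of_nonneg_of_le (fun b' => by positivity) (fun b' => ?_)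
        (((summable_exp_l1 hδ b).mul_left (C * C' * Mg)).mul_right ((2 * (1 - exp (-δ'))⁻¹) ^ d))
      exact mul_le_mul_of_nonneg_left (tsum_exp_l1_le hδ' b') (by positivity)
  have hFsum : Summable (Function.uncurry F) := by
    refine Summable.of_norm_bounded hGsum fun p => ?_
    simp only [Function.uncurry, hF, hG, Real.norm_eq_abs, abs_mul]
    exact mul_le_mul (mul_le_mul (hK b p.1) (hL p.1 p.2) (abs_nonneg _) (by positivity)) (hg p.2) (abs_nonneg _) (by positivity)
  calc ∑' b' : X d, K b b' * ∑' b'' : X d, L b' b'' * g b''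
      = ∑' b' : X d, ∑' b'' : X d, F b' b'' := tsum_congr fun b' => by rw [← tsum_mul_left]; exact tsum_congr fun b'' => by rw [hF]; ring
    _ = ∑' b'' : X d, ∑' b' : X d, F b' b'' := hFsum.tsum_comm.symm
    _ = ∑' b'' : X d, (∑' b' : X d, K b b' * L b' b'') * g b'' := tsum_congr fun b'' => by rw [← tsum_mul_right]

/-! ## §2. THE END: `T_∞` and `M` are mutually inverse bounded operators on `ℓ^∞(ℤ^d)` -/

/-- **HEADLINE — THE INFINITE-VOLUME NEXT-SCALE HESSIAN IS A BOUNDED, BOUNDEDLY INVERTIBLE OPERATOR ON `ℓ^∞(ℤ^d)`**: `d ≥ 3`, `a > 0`,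
`λ < min(2,a)`, `Λ ≥ 0` ⟹ `∃ C > 0` (from `(d, a, λ, Λ)` ONLY) such that for ALL `n`, `V : ℤ^d → [−λ, Λ]`, ANY bounded block columns `Ψ` and
ANY cube limit `M` ((194)): there are `Top, Mop : ℓ^∞ →L[ℝ] ℓ^∞` with `(Top g)(b) = Σ′_{b′}T_∞(b,b′)g(b′)`, `(Mop g)(b) = Σ′_{b′}M(b,b′)g(b′)`,
`‖Top‖, ‖Mop‖ ≤ C`, and `Top(Mop g) = g = Mop(Top g)` for every `g ∈ ℓ^∞(ℤ^d)` — (186)∕(194) decay, §1, and (195)'s kernel identities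
through one Fubini. [folklore] -/
theorem zd_coarse_inverse_clm (hd : 3 ≤ d) (a : ℝ) (ha : 0 < a) {lam Lam : ℝ} (hlam : lam < min 2 a) (hLam : 0 ≤ Lam) :
    ∃ C : ℝ, 0 < C ∧ ∀ (n : ℕ) (V : X d → ℝ), (∀ p, -lam ≤ V p) → (∀ p, V p ≤ Lam) →
      ∀ (Ψ : X d → X d → ℝ) (BΨ : X d → ℝ), (∀ b' p, |Ψ b' p| ≤ BΨ b') →
      (∀ b' p, ((n : ℝ) + 1) ^ 2 * ∑ μ, (2 * Ψ b' p - Ψ b' (p + e μ) - Ψ b' (p - e μ))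
        + a / ((n : ℝ) + 1) ^ d * ∑ q ∈ B n (blk n p), Ψ b' q + V p * Ψ b' p = if blk n p = b' then 1 else 0) →
      ∀ (M : X d → X d → ℝ), (∀ b b' : X d, Tendsto (fun R : ℕ =>
          if h : b ∈ (Fintype.piFinset fun _ : Fin d => Finset.Icc (-(R : ℤ)) R) ∧
              b' ∈ (Fintype.piFinset fun _ : Fin d => Finset.Icc (-(R : ℤ)) R)
            then (Matrix.of fun c c' : ↥(Fintype.piFinset fun _ : Fin d => Finset.Icc (-(R : ℤ)) R) =>
              (((n : ℝ) + 1) ^ d)⁻¹ * ∑ q ∈ B n (c : X d), Ψ (c' : X d) q)⁻¹ ⟨b, h.1⟩ ⟨b', h.2⟩ else 0)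
        atTop (𝓝 (M b b'))) →
      ∃ Top Mop : lp (fun _ : X d => ℝ) ∞ →L[ℝ] lp (fun _ : X d => ℝ) ∞,
        ‖Top‖ ≤ C ∧ ‖Mop‖ ≤ C ∧
        (∀ (g : lp (fun _ : X d => ℝ) ∞) (b : X d), Top g b = ∑' b' : X d, ((((n : ℝ) + 1) ^ d)⁻¹ * ∑ q ∈ B n b, Ψ b' q) * g b') ∧
        (∀ (g : lp (fun _ : X d => ℝ) ∞) (b : X d), Mop g b = ∑' b' : X d, M b b' * g b') ∧
        (∀ g : lp (fun _ : X d => ℝ) ∞, Top (Mop g) = g) ∧ (∀ g : lp (fun _ : X d => ℝ) ∞, Mop (Top g) = g) := by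
  classical
  obtain ⟨Ce, δe, hCe, hδe, H186⟩ := zd_coarse_entry_decay (d := d) hd a ha hlam hLam
  obtain ⟨c₁, δ₁, hc₁, hδ₁, H4⟩ := zd_coarse_section_inverse (d := d) hd a ha hlam hLam
  have hKe : 0 < (2 * (1 - exp (-δe))⁻¹) ^ d := pow_pos (mul_pos two_pos (inv_pos.2 (sub_pos.2 (exp_lt_one_iff.2 (by linarith))))) d
  have hK1 : 0 < (2 * (1 - exp (-δ₁))⁻¹) ^ d := pow_pos (mul_pos two_pos (inv_pos.2 (sub_pos.2 (exp_lt_one_iff.2 (by linarith))))) d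
  refine ⟨Ce * (2 * (1 - exp (-δe))⁻¹) ^ d + c₁ * (2 * (1 - exp (-δ₁))⁻¹) ^ d, by positivity, ?_⟩
  intro n V hV hV' Ψ BΨ hΨB hΨ M hM
  obtain ⟨T, hT⟩ : ∃ T : X d → X d → ℝ, ∀ b b', T b b' = (((n : ℝ) + 1) ^ d)⁻¹ * ∑ q ∈ B n b, Ψ b' q := ⟨_, fun _ _ => rfl⟩
  have hTd : ∀ b b', |T b b'| ≤ Ce * exp (-(δe * ∑ i, (((b i - b' i).natAbs : ℕ) : ℝ))) := fun b b' => by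
    rw [hT]; exact H186 n V hV hV' Ψ BΨ hΨB hΨ b b'
  have hMd : ∀ b b', |M b b'| ≤ c₁ * exp (-(δ₁ * ∑ i, (((b i - b' i).natAbs : ℕ) : ℝ))) := fun b b' => by
    refine le_of_tendsto' (hM b b').abs fun R => ?_
    split_ifs with h
    · exact (H4 n V hV hV' Ψ BΨ hΨB hΨ _ _ (Finset.Subset.refl _)).1 ⟨b, h.1⟩ ⟨b', h.2⟩
    · rw [abs_zero]; positivity
  obtain ⟨Top, hTop_norm, hTop⟩ := kernel_clm hCe.le hδe T hTd
  obtain ⟨Mop, hMop_norm, hMop⟩ := kernel_clm hc₁.le hδ₁ M hMd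
  have hTM : ∀ b b'', ∑' b' : X d, T b b' * M b' b'' = if b = b'' then 1 else 0 := fun b b'' => by
    simp only [hT]; exact (zd_coarse_mul_inverse hd a ha hlam hLam n V hV hV' Ψ BΨ hΨB hΨ M hM b b'').2
  have hMT : ∀ b b'', ∑' b' : X d, M b b' * T b' b'' = if b = b'' then 1 else 0 := fun b b'' => by
    simp only [hT]; exact (zd_coarse_inverse_mul hd a ha hlam hLam n V hV hV' Ψ BΨ hΨB hΨ M hM b b'').2
  refine ⟨Top, Mop, hTop_norm.trans (by linarith [mul_pos hc₁ hK1]), hMop_norm.trans (by linarith [mul_pos hCe hKe]),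
    fun g b => ?_, hMop, fun g => lp.ext (funext fun b => ?_), fun g => lp.ext (funext fun b => ?_)⟩
  · rw [hTop]; exact tsum_congr fun b' => by rw [hT]
  · rw [hTop]
    simp only [hMop]
    rw [kernel_comp_apply hδe hδ₁ T M hTd hMd (fun b'' => g b'') (fun b'' => abs_apply_le_norm g b'') b]
    simp only [hTM]
    rw [tsum_eq_single b (fun b'' hb'' => by rw [if_neg (Ne.symm hb''), zero_mul]), if_pos rfl, one_mul]
  · rw [hMop]
    simp only [hTop]
    rw [kernel_comp_apply hδ₁ hδe M T hMd hTd (fun b'' => g b'') (fun b'' => abs_apply_le_norm g b'') b]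
    simp only [hMT]
    rw [tsum_eq_single b (fun b'' hb'' => by rw [if_neg (Ne.symm hb''), zero_mul]), if_pos rfl, one_mul]

/-! ## §3. Toy -/

/-- Toy (`d = 2`): the zero kernel is a bounded operator on `ℓ^∞(ℤ²)` of norm `≤ 0·K₁`. -/
example : ∃ Kop : lp (fun _ : X 2 => ℝ) ∞ →L[ℝ] lp (fun _ : X 2 => ℝ) ∞,
    ‖Kop‖ ≤ 0 * (2 * (1 - exp (-1))⁻¹) ^ 2 ∧ ∀ (g : lp (fun _ : X 2 => ℝ) ∞) (b : X 2), Kop g b = ∑' b' : X 2, (0 : ℝ) * g b' :=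
  kernel_clm (d := 2) le_rfl one_pos (fun _ _ => 0) (fun b b' => by rw [abs_zero]; positivity)

end Summit.QuantumFields.BalabanUV.T4Continuum.NE7b.SupZdCoarseInverseOperator
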